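/- Copyright: the b2b-balaban cell (near-miss cell 7), T⁴-continuum fan-out, NE7b swarm leaf 04 (gen 7; road W-RP, sub-row
«W3o»: translation-transported template events on the tower ⇒ `E_meas` ∕ `loc` ∕ `sym` of W4b′'s `CutoffReading`).
Released under the licence of the surrounding project. -/
import Summits.QuantumFields.BalabanUV.T4Continuum.Support.HistoryRPTowerCells
import Literature.Barriers.CriticalPhenomena.PositionSpaceRGNonGibbsianChessboard

/-!
# History chessboard road: TEMPLATE EVENTS transported by the tower translations — `E_meas`, `loc`, `sym` as theorems (W3o)

Summits-side support leaf of the T⁴-continuum cell (rung (B)+1 on a FINITE torus only; NOT infinite volume, NOT the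
mass gap, NOT the Clay statement; NOT a proof of the spine estimate NE7b).  Road W-RP (R-OWNER-23-2 ∕ R-OWNER-23-8) of
the swarm claim table `t4/b2b-balaban-t4-ne7b-p1/LEAVES-NE7b.md`, sub-row «W3o» (journal INTENT of leaf-04 g7, l.16733),
on top of W3m (`HistoryRPTowerCuts`: `towerTranslate`, `cutVec`, `cutPos`, `cutRefl`; `HistoryRPTowerCells`) and the
block-torus letters `cellReflect` ∕ `halfPlus` of the tree's chessboard estimate.  [folklore] bookkeeping of the symmetry
group of OUR tower carrier; DATA defs `boxBonds`, `boxAlg`, `towerBox`, `tEvent`; no `structure`, no `[cite:]` tag, no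
`Prop`-valued definition (c1), no constant (c2∕c6), no exit ∕ socket ∕ `HistoryConstants` file (c3); nothing printed
asserted.

WHY.  After W3m, W4b′'s per-cutoff reading `CutoffReading` (and W4c's `EventSide`) has, for the tower law on `Tower P G K`
(top lattice `Site P K` = `BlockIdx P.d N`, `N := P.sitesPerDir K`), its five RP fields BY NAME; the EVENT-GEOMETRY
fields `loc` (`∀ c ∈ halfPlus N i k, MeasurableSet[mP i k] (E l c)`) and `sym` (`θ i k ⁻¹' E l c = E l (cellReflect i k c)`)
stay displayed for whatever events the instantiating seat chooses.  The natural event model is «ONE TEMPLATE per pattern,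
read in the reference column at the origin and CARRIED TO EVERY CELL by the tower translations»: `tEvent K tmpl c :=
(towerTranslate K c) ⁻¹' tmpl`.  Then `loc` is a THEOREM once the template is measurable in the reference column (§2–§3)
and `sym` is a THEOREM once the template has the ONE-SET reflection symmetry `(towerRefl i K) ⁻¹' tmpl =
(towerTranslate K (−e_i)) ⁻¹' tmpl` per axis («the reflected template is the template carried to the mirror cell») — by
the action algebra of §1 (`T_a ∘ T_b = T_{a+b}`, `R_i ∘ T_a = T_{σ_i a} ∘ R_i`).

WHAT.
* §1 ACTION ALGEBRA (induction on the tower): `scale_reflect`, `towerTranslate_towerTranslate` (`T_a ∘ T_b = T_{a+b}`),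
  `creflect_translate` (one field), `towerRefl_towerTranslate` (`R_ρ ∘ T_a = T_{σ_ρ a} ∘ R_ρ`), `towerTranslate_towerRefl`.
* §2 THE REFERENCE COLUMN: `boxBonds P j s` (bonds with both endpoints' labels `< s` in every direction), the σ-algebra
  `boxAlg G j s` they generate, the tower's `towerBox G K M k` (side `M·L^{K−k}` at level `k`: the bonds under the top
  cube of side `M` at the origin; `M = 1` a unit cell, `M = L^{m₁}` W4c's cube cells); generators
  (`measurable_coord_boxAlg`, `measurable_fst_towerBox`, `measurable_snd_towerBox`, `towerBox_le`); the positivity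
  transport **`measurable_translate_boxAlg`** (one level) and **`measurable_towerTranslate_box`** (the tower):
  `Measurable[towerPos G i k, towerBox G K M k] (towerTranslate k a)` whenever `(a i).val + M·L^{K−k} ≤ N_k ∕ 2`.
* §3 TEMPLATE EVENTS `tEvent`: **`measurableSet_tEvent`**; GENERAL forms (any cube side `M`, any translation vector,
  any mirror offset `w`) **`measurableSet_tEvent_cutPos`**, **`preimage_cutRefl_tEvent`**; UNIT-CELL forms
  `measurableSet_tEvent_cutPos_cell` (`c ∈ halfPlus N i k`), `preimage_cutRefl_tEvent_cell` (`= tEvent K tmpl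
  (cellReflect i k c)`); §3b the three in W4b′∕W4c's binder shapes (unit cells, `θ := cutRefl K`, `mP := cutPos G K`) for
  a pattern family `tmpl : Λ → Set (Tower P G K)`: `tEvent_E_meas`, `tEvent_loc`, `tEvent_sym`.
* §4 sanity: a box-cylinder template is reference-column measurable; its template event is `cutPos`-measurable.

HONEST SCOPE.  What it gives an instantiating seat of W4b′∕W4c on the tower carrier: `E_meas`, `loc`, `sym` BY NAME for
template events; still displayed: that Bałaban's bad ∕ large-field events ARE template events and WHICH template ((EXT):
`repr` ∕ `ev_cover` ∕ `bad_disj` ∕ `bad_sub`), the reflection symmetry `hR` OF THAT TEMPLATE (the (R-sym) sentence, now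
one set identity per axis), `univ_le` ((U1)+(G2)); the typing identification «`blockAvg ℰ` is Bałaban's (0.4)» is
T-class.  Division with sub-row W3n (`HistoryRPTowerColumns`, leaf-07 g5: column σ-algebras `colAlg K S`, cut
measurability): independent files; `towerBox G K 1 K` = its `colAlg G K {0}` (bridge by the later file).  NE7b NOT
proved; spine 0∕9.  HONEST DEPENDENCY (cell): continuum YM on T⁴ ⇐ BetaPertH ∧ nine spine estimates (0/9 proved);
BetaPertH ⇐ (D1) ∧ (D4) ∧ CAP+tail; G-an2-4 gates asym, D1 and NE2/3/4.  This file changes none of it. -/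

open MeasureTheory
open Literature.Barriers.CriticalPhenomena.NonGibbs
open Literature.MathematicalPhysics.QuantumFieldTheory
open Literature.MathematicalPhysics.QuantumFieldTheory.Balaban1983to89
open T4UndoubledRP
open Summit.QuantumFields.BalabanUV.T4Continuum.HistoryRPHalfTorus
open Summit.QuantumFields.BalabanUV.T4Continuum.HistoryRPTwoLevel (prod_le_prod)
open Summit.QuantumFields.BalabanUV.T4Continuum.HistoryRPTowerLaw
open Summit.QuantumFields.BalabanUV.T4Continuum.HistoryRPTowerCuts
open Summit.QuantumFields.BalabanUV.T4Continuum.HistoryRPTowerCells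

namespace Summit.QuantumFields.BalabanUV.T4Continuum.HistoryRPTowerTemplates

noncomputable section

variable {P : Params} {G : Type*}
/-! ## §1 The action algebra of tower translations and reflections -/

section Action

/-- subtraction of sites is coordinatewise. [folklore] -/
theorem site_sub_apply {j : ℕ} (x y : Site P j) (μ : Fin P.d) : (x - y) μ = x μ - y μ := rfl

/-- **`Site.scale` COMMUTES WITH THE AXIS REFLECTION**: `L·(σ_ρ a) = σ_ρ (L·a)` (`scaleCoord` is additive). [folklore] -/
theorem scale_reflect {j : ℕ} (ρ : Fin P.d) (a : Site P (j + 1)) :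
    Site.scale (a.reflect ρ) = (Site.scale a).reflect ρ := by
  funext μ
  rw [Site.scale_apply, Site.reflect_apply, Site.reflect_apply, Site.scale_apply]
  split_ifs with h
  exacts [map_neg _ _, rfl]

/-- **`T_a ∘ T_b = T_{a+b}` ON THE TOWER** (induction; `Site.scale` additive). [folklore] -/
theorem towerTranslate_towerTranslate : ∀ (k : ℕ) (a b : Site P k) (ω : Tower P G k),
    towerTranslate k a (towerTranslate k b ω) = towerTranslate k (a + b) ω
  | 0, a, b, U => GaugeField.translate_translate a b U
  | k + 1, a, b, ω => by
    obtain ⟨ω', V⟩ := ω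
    show (towerTranslate k (Site.scale a) (towerTranslate k (Site.scale b) ω'),
        (GaugeField.translate b V).translate a) = (towerTranslate k (Site.scale (a + b)) ω', V.translate (a + b))
    rw [towerTranslate_towerTranslate k, map_add, GaugeField.translate_translate]

variable [GaugeGroup G]

/-- **`c_ρ ∘ τ_a = τ_{σ_ρ a} ∘ c_ρ` ON FIELDS** (pull-backs):
`(U.translate a).creflect ρ = (U.creflect ρ).translate (a.reflect ρ)` (the tree's `gaugeField_reflect_translate` for the
site reflection, and `creflect = reflect ∘ translate (−e_ρ)`). [folklore] -/
theorem creflect_translate {j : ℕ} (ρ : Fin P.d) (a : Site P j) (U : GaugeField P j G) :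
    (U.translate a).creflect ρ = (U.creflect ρ).translate (a.reflect ρ) := by
  rw [GaugeField.creflect_eq, GaugeField.creflect_eq, GaugeField.translate_translate,
    ← Site.reflect_reflect ρ a, ← gaugeField_reflect_translate, Site.reflect_reflect, GaugeField.translate_translate,
    add_comm]

/-- **`R_ρ ∘ T_a = T_{σ_ρ a} ∘ R_ρ` ON THE TOWER** (induction; `creflect_translate` on every level, `scale_reflect`).
[folklore] -/
theorem towerRefl_towerTranslate (ρ : Fin P.d) : ∀ (k : ℕ) (a : Site P k) (ω : Tower P G k),
    towerRefl ρ k (towerTranslate k a ω) = towerTranslate k (a.reflect ρ) (towerRefl ρ k ω)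
  | 0, a, U => creflect_translate ρ a U
  | k + 1, a, ω => by
    obtain ⟨ω', V⟩ := ω
    show (towerRefl ρ k (towerTranslate k (Site.scale a) ω'), (GaugeField.translate a V).creflect ρ) =
      (towerTranslate k (Site.scale (a.reflect ρ)) (towerRefl ρ k ω'), (V.creflect ρ).translate (a.reflect ρ))
    rw [towerRefl_towerTranslate ρ k, scale_reflect, creflect_translate]

/-- … equivalently `T_a ∘ R_ρ = R_ρ ∘ T_{σ_ρ a}`. [folklore] -/
theorem towerTranslate_towerRefl (ρ : Fin P.d) (k : ℕ) (a : Site P k) (ω : Tower P G k) :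
    towerTranslate k a (towerRefl ρ k ω) = towerRefl ρ k (towerTranslate k (a.reflect ρ) ω) := by
  rw [towerRefl_towerTranslate, Site.reflect_reflect]

end Action

/-! ## §2 The reference column: box bonds, their σ-algebras, positivity after translation -/

section Box

/-- **THE BOX BONDS of side `s` at level `j`**: both endpoints carry labels `< s` in EVERY direction (for `s = L^{K−j}`:
the level-`j` bonds under the top cell `0` of a tower of height `K`). -/
def boxBonds (P : Params) (j s : ℕ) : Finset (PBond P j) :=
  Finset.univ.filter fun b => ∀ μ : Fin P.d, (b.src μ).val < s ∧ (b.tgt μ).val < s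

/-- membership in `boxBonds`. [folklore] -/
@[simp] theorem mem_boxBonds {j s : ℕ} {b : PBond P j} :
    b ∈ boxBonds P j s ↔ ∀ μ : Fin P.d, (b.src μ).val < s ∧ (b.tgt μ).val < s := by
  simp [boxBonds]

variable (G) [MeasurableSpace G]

/-- **THE BOX σ-ALGEBRA** at level `j`: events of the level-`j` field depending only on the box bonds (`piFinset`). -/
abbrev boxAlg (j s : ℕ) : MeasurableSpace (GaugeField P j G) :=
  (Filtration.piFinset (X := fun _ : PBond P j => G) (boxBonds P j s) : MeasurableSpace (PBond P j → G))

/-- **THE REFERENCE-COLUMN σ-ALGEBRA OF A TOWER OF HEIGHT `K` UNDER A TOP CUBE OF SIDE `M`**, read up to level `k`: the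
box bonds of side `M·L^{K−k'}` of every level `k' ≤ k` (recursion as `towerPos`).  `M = 1`: the column under ONE top cell
(W4b′∕W4c's unit cells `BlockIdx P.d (P.sitesPerDir K)`; the top box then has side `1` and no bond — such templates read
the levels `< K`); `M = L^{m₁}`: the column under a top CUBE of `M^d` cells (W4c's cube cells), top-level bonds inside the
cube included. -/
@[reducible] def towerBox (K M : ℕ) : (k : ℕ) → MeasurableSpace (Tower P G k)
  | 0 => boxAlg G 0 (M * P.L ^ (K - 0))
  | k + 1 => (towerBox K M k).prod (boxAlg G (k + 1) (M * P.L ^ (K - (k + 1))))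

variable {G}

/-- `boxAlg ≤` the product σ-algebra. [folklore] -/
theorem boxAlg_le (j s : ℕ) : boxAlg G j s ≤ (inferInstance : MeasurableSpace (GaugeField P j G)) :=
  (Filtration.piFinset (X := fun _ : PBond P j => G)).le _

/-- `towerBox ≤` the tower's σ-algebra. [folklore] -/
theorem towerBox_le (K M : ℕ) :
    ∀ k : ℕ, towerBox G K M k ≤ (instMeasurableSpaceTower P G k : MeasurableSpace (Tower P G k))
  | 0 => boxAlg_le 0 _
  | k + 1 => prod_le_prod (towerBox_le K M k) (boxAlg_le (k + 1) _)

/-- the restriction to the box bonds is `boxAlg`-measurable (definition of `piFinset`). [folklore] -/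
theorem measurable_restrict_boxAlg (j s : ℕ) :
    Measurable[boxAlg G j s] ((boxBonds P j s).restrict : GaugeField P j G → (↥(boxBonds P j s) → G)) :=
  measurable_iff_comap_le.2 le_rfl

/-- GENERATORS: a box coordinate is `boxAlg`-measurable. [folklore] -/
theorem measurable_coord_boxAlg {j s : ℕ} {b : PBond P j} (hb : b ∈ boxBonds P j s) :
    @Measurable _ _ (boxAlg G j s) _ fun U : GaugeField P j G => U b :=
  (measurable_pi_apply (⟨b, hb⟩ : ↥(boxBonds P j s))).comp (measurable_restrict_boxAlg j s)

/-- GENERATORS, top field: the top field is measurable from `towerBox` to its box algebra. [folklore] -/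
theorem measurable_snd_towerBox (K M k : ℕ) :
    @Measurable _ _ (towerBox G K M (k + 1)) (boxAlg G (k + 1) (M * P.L ^ (K - (k + 1))))
      (Prod.snd : Tower P G (k + 1) → GaugeField P (k + 1) G) :=
  @measurable_snd _ _ (towerBox G K M k) (boxAlg G (k + 1) (M * P.L ^ (K - (k + 1))))

/-- GENERATORS, prefix: `Prod.fst` descends `towerBox`. [folklore] -/
theorem measurable_fst_towerBox (K M k : ℕ) :
    @Measurable _ _ (towerBox G K M (k + 1)) (towerBox G K M k) (Prod.fst : Tower P G (k + 1) → Tower P G k) :=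
  @measurable_fst _ _ (towerBox G K M k) (boxAlg G (k + 1) (M * P.L ^ (K - (k + 1))))

/-- the label of a scaled coordinate: `(L·n).val = n.val · L` in the standing range. [folklore] -/
theorem val_scaleCoord {j : ℕ} (hj : j + 1 ≤ P.m + P.K) (n : ZMod (P.sitesPerDir (j + 1))) :
    (Site.scaleCoord P j n).val = n.val * P.L := by
  rw [Site.scaleCoord_apply, ZMod.val_natCast, Nat.mod_eq_of_lt]
  rw [P.sitesPerDir_eq_mul_succ hj]
  exact Nat.mul_lt_mul_of_pos_right (ZMod.val_lt n) P.L_pos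

/-- **POSITIVITY AFTER TRANSLATION, one level**: if `(a i).val + s ≤ N_j ∕ 2` then translating by `a` reads the box of
side `s` inside the positive half of axis `i`: `Measurable[mPos G j i, boxAlg G j s] (translate a)` (each box bond `b`
has `b.translate a ∈ posBonds`). [folklore] -/
theorem measurable_translate_boxAlg (i : Fin P.d) {j s : ℕ} (a : Site P j)
    (ha : (a i).val + s ≤ P.sitesPerDir j / 2) :
    @Measurable _ _ (mPos G j i) (boxAlg G j s) (GaugeField.translate (G := G) a) := by
  refine measurable_comap_iff.2 (@measurable_pi_lambda _ _ _ (_) _ _ fun b => ?_)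
  have hb : (b : PBond P j) ∈ boxBonds P j s := Finset.mem_coe.1 b.2
  rw [mem_boxBonds] at hb
  have hN : P.sitesPerDir j / 2 ≤ P.sitesPerDir j := Nat.div_le_self _ _
  have hpos : (b : PBond P j).translate a ∈ posBonds P j i := by
    rw [mem_posBonds]
    have hs := (hb i).1
    have ht := (hb i).2
    have e1 : (((b : PBond P j).translate a).src i) = (b : PBond P j).src i + a i := rfl
    have e2 : (((b : PBond P j).translate a).tgt i) = (b : PBond P j).tgt i + a i := by
      show (((b : PBond P j).src + a).shift (b : PBond P j).dir) i = _
      rw [Site.shift_add]; rfl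
    rw [e1, e2, ZMod.val_add_of_lt (by omega), ZMod.val_add_of_lt (by omega)]
    omega
  show @Measurable _ _ (mPos G j i) _ fun U : GaugeField P j G => U ((b : PBond P j).translate a)
  exact (measurable_pi_apply (⟨_, hpos⟩ : ↥(posBonds P j i))).comp (measurable_restrict_mPos G j i)

/-- **POSITIVITY AFTER TRANSLATION, the tower**: for `k ≤ K ≤ m + P.K` and a level-`k` vector `a` with
`(a i).val + M·L^{K−k} ≤ N_k ∕ 2` (the column under the top cube of side `M` at the origin, translated by `a`, lies in
the positive half of axis `i` at every level `≤ k`), `Measurable[towerPos G i k, towerBox G K M k] (towerTranslate k a)`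
— induction down the tower (`Site.scale` multiplies labels by `L`, `N_k ∕ 2 = L · N_{k+1} ∕ 2`). [folklore] -/
theorem measurable_towerTranslate_box (i : Fin P.d) (K M : ℕ) (hK : K ≤ P.m + P.K) :
    ∀ k : ℕ, k ≤ K → ∀ a : Site P k, (a i).val + M * P.L ^ (K - k) ≤ P.sitesPerDir k / 2 →
      @Measurable _ _ (towerPos G i k) (towerBox G K M k) (towerTranslate (G := G) k a)
  | 0, _, a, ha => measurable_translate_boxAlg i a ha
  | k + 1, hk, a, ha => by
    have hj : k + 1 ≤ P.m + P.K := hk.trans hK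
    have ha' : (Site.scale a i).val + M * P.L ^ (K - k) ≤ P.sitesPerDir k / 2 := by
      rw [Site.scale_apply, val_scaleCoord hj, half_sitesPerDir_eq_mul hj,
        show K - k = (K - (k + 1)) + 1 by omega, pow_succ, ← mul_assoc, ← add_mul]
      exact Nat.mul_le_mul_right _ ha
    exact @Measurable.prodMap _ _ _ _ (towerPos G i k) (towerBox G K M k) (mPos G (k + 1) i)
      (boxAlg G (k + 1) (M * P.L ^ (K - (k + 1)))) _ _
      (measurable_towerTranslate_box i K M hK k (Nat.le_of_succ_le hk) (Site.scale a) ha')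
      (measurable_translate_boxAlg i a ha)

end Box

/-! ## §3 Template events: one template, carried to every cell by the tower translations -/

section Template

/-- **THE TEMPLATE EVENT AT THE TOP VECTOR `c`**: the template `tmpl` (read in the reference column at the origin)
carried by the tower translation `T_c` — `ω ∈ tEvent K tmpl c ↔ towerTranslate K c ω ∈ tmpl` (unit cells: `c` = the cell;
cube cells of side `M`: `c` = the cube's corner `M·(cube index)`). -/
def tEvent (K : ℕ) (tmpl : Set (Tower P G K)) (c : Site P K) : Set (Tower P G K) := (towerTranslate K c) ⁻¹' tmpl

/-- membership in a template event. [folklore] -/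
theorem mem_tEvent {K : ℕ} {tmpl : Set (Tower P G K)} {c : Site P K} {ω : Tower P G K} :
    ω ∈ tEvent K tmpl c ↔ towerTranslate K c ω ∈ tmpl := Iff.rfl

variable [MeasurableSpace G]

/-- **`E_meas`**: template events of a measurable template are measurable. [folklore] -/
theorem measurableSet_tEvent {K : ℕ} {tmpl : Set (Tower P G K)} (htm : MeasurableSet tmpl) (c : Site P K) :
    MeasurableSet (tEvent K tmpl c) :=
  measurable_towerTranslate K c htm

/-- a reference-column-measurable template is measurable. [folklore] -/
theorem measurableSet_of_towerBox {K M : ℕ} {tmpl : Set (Tower P G K)} (htm : MeasurableSet[towerBox G K M K] tmpl) :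
    MeasurableSet tmpl :=
  towerBox_le K M K tmpl htm

/-- **`loc`, GENERAL FORM**: for `K ≤ m + P.K`, a template measurable in the reference column under the top cube of
side `M`, and a translation vector `v` whose cube lies in the positive half of the cut `(i, k)` with its far face included
(`((v − k e_i) i).val + M ≤ N_K ∕ 2`), the template event at `v` is measurable for the cut's positive algebra
`cutPos G K i k` — `tEvent K tmpl v = T_{k e_i}⁻¹' (T_{v − k e_i}⁻¹' tmpl)`. [folklore] -/
theorem measurableSet_tEvent_cutPos {K M : ℕ} (hK : K ≤ P.m + P.K) {tmpl : Set (Tower P G K)}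
    (htm : MeasurableSet[towerBox G K M K] tmpl) {i : Fin P.d} {k : ZMod (P.sitesPerDir K)} {v : Site P K}
    (hv : ((v - cutVec K i k) i).val + M ≤ P.sitesPerDir K / 2) :
    MeasurableSet[cutPos G K i k] (tEvent K tmpl v) := by
  have hcv : ((v - cutVec K i k) i).val + M * P.L ^ (K - K) ≤ P.sitesPerDir K / 2 := by
    rwa [Nat.sub_self, pow_zero, mul_one]
  refine MeasurableSpace.measurableSet_comap.2 ⟨(towerTranslate K (v - cutVec K i k)) ⁻¹' tmpl,
    measurable_towerTranslate_box i K M hK K le_rfl _ hcv htm, ?_⟩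
  ext ω
  simp only [Set.mem_preimage, mem_tEvent, towerTranslate_towerTranslate, sub_add_cancel]

/-- **`loc`, UNIT CELLS** (`M = 1`): a reference-column-measurable template and a top cell `c` of the positive half
(`(c i − k).val < N ∕ 2`, i.e. `c ∈ halfPlus N i k`, `N := P.sitesPerDir K`) give a `cutPos G K i k`-measurable template
event at `c`. [folklore] -/
theorem measurableSet_tEvent_cutPos_cell {K : ℕ} (hK : K ≤ P.m + P.K) {tmpl : Set (Tower P G K)}
    (htm : MeasurableSet[towerBox G K 1 K] tmpl) {i : Fin P.d} {k : ZMod (P.sitesPerDir K)} {c : Site P K}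
    (hc : (c i - k).val < P.sitesPerDir K / 2) :
    MeasurableSet[cutPos G K i k] (tEvent K tmpl c) := by
  refine measurableSet_tEvent_cutPos hK htm ?_
  rw [site_sub_apply]
  have : cutVec K i k i = k := by simp [cutVec]
  rw [this]
  exact hc

variable [GaugeGroup G]

omit [MeasurableSpace G] in
/-- **`sym`, GENERAL FORM**: if the template reflected through the centre hyperplane of axis `i` is the template carried
by `T_w` (`(towerRefl i K)⁻¹' tmpl = (towerTranslate K w)⁻¹' tmpl`; unit cells: `w = −e_i`, the mirror cell; cubes of side
`M`: `w = −M·e_i`, the mirror cube's corner), then the cut reflection of EVERY hyperplane `(i, k)` carries the template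
event at `v` to the one at `w + (σ_i (v − k e_i) + k e_i)` (§1: `T_v ∘ cutRefl = T_{v − k e_i} ∘ R_i ∘ T_{k e_i} =
R_i ∘ T_{σ_i(v − k e_i) + k e_i}`). [folklore] -/
theorem preimage_cutRefl_tEvent {K : ℕ} {tmpl : Set (Tower P G K)} {i : Fin P.d} {w : Site P K}
    (hR : (towerRefl i K) ⁻¹' tmpl = (towerTranslate K w) ⁻¹' tmpl) (k : ZMod (P.sitesPerDir K)) (v : Site P K) :
    (cutRefl K i k) ⁻¹' tEvent K tmpl v = tEvent K tmpl (w + ((v + -cutVec K i k).reflect i + cutVec K i k)) := by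
  ext ω
  have hRω := Set.ext_iff.1 hR (towerTranslate K ((v + -cutVec K i k).reflect i + cutVec K i k) ω)
  rw [Set.mem_preimage, Set.mem_preimage] at hRω
  simp only [Set.mem_preimage, mem_tEvent, cutRefl]
  rw [towerTranslate_towerTranslate, towerTranslate_towerRefl, towerTranslate_towerTranslate,
    ← towerTranslate_towerTranslate K w ((v + -cutVec K i k).reflect i + cutVec K i k) ω]
  exact hRω

omit [MeasurableSpace G] in
/-- the vector identity of the unit-cell case: `−e_i + (σ_i (c − k e_i) + k e_i) = cellReflect i k c`
(`= Function.update c i (2k − 1 − c i)`). [folklore] -/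
theorem unshift_add_reflect_eq_cellReflect {K : ℕ} (i : Fin P.d) (k : ZMod (P.sitesPerDir K)) (c : Site P K) :
    (0 : Site P K).unshift i + ((c + -cutVec K i k).reflect i + cutVec K i k) = (cellReflect i k c : Site P K) := by
  funext μ
  by_cases h : μ = i
  · subst h
    simp only [Site.add_apply, Site.unshift_apply, Site.reflect_apply, site_neg_apply, Site.zero_apply,
      cellReflect_apply, if_true, Function.update_self, cutVec, Pi.single_eq_same]
    ring
  · simp only [Site.add_apply, Site.unshift_apply, Site.reflect_apply, site_neg_apply, Site.zero_apply,
      cellReflect_apply, if_neg h, Function.update_of_ne h, cutVec, Pi.single_eq_of_ne h]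
    ring

omit [MeasurableSpace G] in
/-- **`sym`, UNIT CELLS**: if the template has the reflection symmetry of axis `i` — `(towerRefl i K)⁻¹' tmpl =
(towerTranslate K (−e_i))⁻¹' tmpl`, «the template reflected through the centre hyperplane is the template carried to the
mirror cell `−e_i`» (`−e_i` = the tree's letter `(0 : Site P K).unshift i` of `GaugeField.creflect`) — then the cut
reflection of EVERY block hyperplane `(i, k)` carries the template event at `c` to the one at `cellReflect i k c`:
`cutRefl K i k ⁻¹' tEvent K tmpl c = tEvent K tmpl (cellReflect i k c)`. [folklore] -/
theorem preimage_cutRefl_tEvent_cell {K : ℕ} {tmpl : Set (Tower P G K)} {i : Fin P.d}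
    (hR : (towerRefl i K) ⁻¹' tmpl = (towerTranslate K ((0 : Site P K).unshift i)) ⁻¹' tmpl)
    (k : ZMod (P.sitesPerDir K)) (c : Site P K) :
    (cutRefl K i k) ⁻¹' tEvent K tmpl c = tEvent K tmpl (cellReflect i k c) := by
  rw [preimage_cutRefl_tEvent hR k c, unshift_add_reflect_eq_cellReflect]

end Template

/-! ## §3b In W4b′'s binder shapes: a pattern family of templates -/

section Reading

variable [MeasurableSpace G] {Λ : Type*} {Pat : Finset Λ} {K : ℕ} {tmpl : Λ → Set (Tower P G K)}

/-- **`CutoffReading.E_meas` FOR TEMPLATE EVENTS** (`E l c := tEvent K (tmpl l) c`). [folklore] -/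
theorem tEvent_E_meas (htm : ∀ l ∈ Pat, MeasurableSet (tmpl l)) :
    ∀ l ∈ Pat, ∀ c : BlockIdx P.d (P.sitesPerDir K), MeasurableSet (tEvent K (tmpl l) c) :=
  fun l hl c => measurableSet_tEvent (htm l hl) c

/-- **`CutoffReading.loc` FOR TEMPLATE EVENTS** (unit cells; `mP := cutPos G K`, `N := P.sitesPerDir K`):
reference-column-measurable templates give positive-half-measurable events at every positive-half cell of every block
hyperplane. [folklore] -/
theorem tEvent_loc (hK : K ≤ P.m + P.K) (htm : ∀ l ∈ Pat, MeasurableSet[towerBox G K 1 K] (tmpl l)) :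
    ∀ l ∈ Pat, ∀ (i : Fin P.d) (k : ZMod (P.sitesPerDir K)), ∀ c ∈ halfPlus (P.sitesPerDir K) i k,
      MeasurableSet[cutPos G K i k] (tEvent K (tmpl l) c) :=
  fun l hl _ _ _ hc => measurableSet_tEvent_cutPos_cell hK (htm l hl) (mem_halfPlus.1 hc)

variable [GaugeGroup G]

omit [MeasurableSpace G] in
/-- **`CutoffReading.sym` FOR TEMPLATE EVENTS** (unit cells; `θ := cutRefl K`): templates with the reflection symmetry
of every axis give reflection-related events at every block hyperplane. [folklore] -/
theorem tEvent_sym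
    (hR : ∀ l ∈ Pat, ∀ i : Fin P.d,
      (towerRefl i K) ⁻¹' tmpl l = (towerTranslate K ((0 : Site P K).unshift i)) ⁻¹' tmpl l) :
    ∀ l ∈ Pat, ∀ (i : Fin P.d) (k : ZMod (P.sitesPerDir K)) (c : BlockIdx P.d (P.sitesPerDir K)),
      (cutRefl K i k) ⁻¹' tEvent K (tmpl l) c = tEvent K (tmpl l) (cellReflect i k c) :=
  fun l hl i k c => preimage_cutRefl_tEvent_cell (hR l hl i) k c

end Reading

/-! ## §4 Sanity -/

section Sanity

variable [MeasurableSpace G]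

/-- A reference-column CYLINDER template: `{ω | ω.2 b ∈ A}` for a box bond `b` of level `k + 1` (read in a tower of
height `K` truncated at `k + 1`) and a measurable `A ⊆ G` is `towerBox`-measurable (generators `measurable_snd_towerBox` +
`measurable_coord_boxAlg`). -/
example (K M k : ℕ) {b : PBond P (k + 1)} (hb : b ∈ boxBonds P (k + 1) (M * P.L ^ (K - (k + 1)))) {A : Set G}
    (hA : MeasurableSet A) :
    MeasurableSet[towerBox G K M (k + 1)] {ω : Tower P G (k + 1) | ω.2 b ∈ A} :=
  ((measurable_coord_boxAlg hb).comp (measurable_snd_towerBox K M k)) hA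

/-- … and, for a TOP cube of side `M` (a top-level box bond `b` of the reference cube, `K = k + 1`), the template event at
a translation vector `v` whose cube lies in the positive half of the cut `(i, κ)` is `cutPos`-measurable (§3). -/
example (k M : ℕ) (hK : k + 1 ≤ P.m + P.K) {b : PBond P (k + 1)}
    (hb : b ∈ boxBonds P (k + 1) (M * P.L ^ (k + 1 - (k + 1)))) {A : Set G} (hA : MeasurableSet A) {i : Fin P.d}
    {κ : ZMod (P.sitesPerDir (k + 1))} {v : Site P (k + 1)}
    (hv : ((v - cutVec (k + 1) i κ) i).val + M ≤ P.sitesPerDir (k + 1) / 2) :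
    MeasurableSet[cutPos G (k + 1) i κ] (tEvent (k + 1) {ω : Tower P G (k + 1) | ω.2 b ∈ A} v) :=
  measurableSet_tEvent_cutPos hK (((measurable_coord_boxAlg hb).comp (measurable_snd_towerBox (k + 1) M k)) hA) hv

end Sanity

end

end Summit.QuantumFields.BalabanUV.T4Continuum.HistoryRPTowerTemplates
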